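import Mathlib
import Summits.Ventures.HodgeRepro.Tier3IsotypicIsolation

/-!
# Tier3IsotypicComponentIsolation — the isolation step (b4) in Mathlib's own vocabulary: the `π`-isotypic
part IS `isotypicComponent`, and its `End`-stability is Mathlib's (T3.5 for T3.1; PERIOD.md §4.3 (b2)/(b4))

Tier3HeckeIsolation (row 616) and Tier3IsotypicIsolation (row 709) state the isolation lemma for an abstract
pair `N₀`, `N₀'` of complementary submodules both STABLE under `Module.End R M` — the hypotheses `hN₀`, `hN₀'`
that encode «the `π`-isotypic component and the sum of the others are preserved by every Hecke-equivariant
endomorphism» (Hom between non-isomorphic isotypic components is `0`).  Mathlib has the objects and the facts: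
`isotypicComponent R M S` (the sum of all submodules isomorphic to `S`), `isotypicComponents R M` (the set of
them), `sSupIndep_isotypicComponents` (they are independent) and `Submodule.IsFullyInvariant.isotypicComponent`
(each is fully invariant).  This file instantiates the lemma there, so that the two stability hypotheses are
DISCHARGED rather than assumed:
* `sSup_isotypicComponents_eq_top` — a semisimple module is the sum of its isotypic components;
* `isCompl_sSup_isotypicComponents_diff` — an isotypic component `c` and the sum `c'` of the OTHER isotypic
  components are complementary;
* `isFullyInvariant_sSup_isotypicComponents_diff` — that sum is fully invariant;
* **`exists_smul_pairing_ne_zero_isotypicComponent`** — (b4) with `N₀ := isotypicComponent R M N`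
  (`N = Θ(τ)_f^K` simple) and `N₀' :=` the sum of the other isotypic components: `B` vanishing on `N₀ × N₀'`
  and non-degenerate on `N`, the `N₀`-components of `u`, `u'` in `N` and non-zero ⇒ `∃ r, B (r • u) u' ≠ 0`;
* **`exists_smul_pairing_ne_zero_of_add`** — the same with `u = n + w`, `u' = n' + w'` (`n, n' ∈ N` non-zero,
  `w, w' ∈ N₀'`): «`θ₀ ∧ θ₁ = u_τ + (the other components)`», no projection in the statement.
What stays on the page: semisimplicity of `H^{2,0}(Sh(G)_K)` over the Hecke algebra (unitarity), `Θ(τ)`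
irreducible when non-zero, the Hodge pairing orthogonal across non-isomorphic isotypic components (unitarity +
Schur) and non-degenerate on `Θ(τ)` (unitarity).  No definition, no notation; imports Mathlib and
Tier3IsotypicIsolation (`exists_smul_pairing_ne_zero_of_le`).
Nothing here asserts anything about the original programme; HC_CM is NOT proved by anyone in this repository.
-/

namespace HodgeRepro.T3P1.IsotypicComponentIsolation

open Module Submodule

variable {R : Type*} [Ring R] {M : Type*} [AddCommGroup M] [Module R M]

section Components

/-- A semisimple module is the sum of its isotypic components. -/
theorem sSup_isotypicComponents_eq_top [IsSemisimpleModule R M] :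
    sSup (isotypicComponents R M) = ⊤ := by
  rw [eq_top_iff, ← IsSemisimpleModule.sSup_simples_eq_top R M]
  refine sSup_le fun S hS => ?_
  haveI : IsSimpleModule R S := hS
  exact S.le_isotypicComponent.trans (le_sSup ⟨S, hS, rfl⟩)

/-- An isotypic component `c` and the sum of the OTHER isotypic components are complementary. -/
theorem isCompl_sSup_isotypicComponents_diff [IsSemisimpleModule R M] {c : Submodule R M}
    (hc : c ∈ isotypicComponents R M) :
    IsCompl c (sSup (isotypicComponents R M \ {c})) := by
  refine ⟨(sSupIndep_isotypicComponents R M).disjoint_sSup hc Set.sdiff_subset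
    (fun h => h.2 (Set.mem_singleton c)), ?_⟩
  rw [codisjoint_iff, ← sSup_insert, Set.insert_sdiff_self_of_mem hc,
    sSup_isotypicComponents_eq_top]

/-- The sum of a set of isotypic components is fully invariant (stable under every endomorphism). -/
theorem isFullyInvariant_sSup_of_subset {s : Set (Submodule R M)}
    (hs : s ⊆ isotypicComponents R M) : (sSup s).IsFullyInvariant := fun f =>
  sSup_le fun _ hN =>
    (Submodule.IsFullyInvariant.of_mem_isotypicComponents (hs hN) f).trans
      (Submodule.comap_mono (le_sSup hN))

/-- The sum of the isotypic components other than `c` is fully invariant. -/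
theorem isFullyInvariant_sSup_isotypicComponents_diff (c : Submodule R M) :
    (sSup (isotypicComponents R M \ {c})).IsFullyInvariant :=
  isFullyInvariant_sSup_of_subset Set.sdiff_subset

/-- Full invariance in the form the isolation lemmas take it: `f x ∈ N` for `x ∈ N`. -/
theorem apply_mem_of_isFullyInvariant {N : Submodule R M} (hN : N.IsFullyInvariant)
    (f : Module.End R M) {x : M} (hx : x ∈ N) : f x ∈ N :=
  hN f hx

/-- The isotypic component of a simple submodule `N` is one of the isotypic components. -/
theorem isotypicComponent_mem_isotypicComponents (N : Submodule R M) [IsSimpleModule R N] :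
    isotypicComponent R M N ∈ isotypicComponents R M :=
  ⟨N, inferInstance, rfl⟩

end Components

section Isolation

variable [IsSemisimpleModule R M] {k : Type*} [AddCommGroup k]

/-- **(b4) in Mathlib's vocabulary.** `N` a simple submodule (`Θ(τ)_f^K`), `N₀ := isotypicComponent R M N`
(the `π`-isotypic part), `N₀' :=` the sum of the other isotypic components; `B : M → M → k` additive in its
second argument, vanishing on `N₀ × N₀'`, non-degenerate on `N`.  If the `N₀`-components of `u` and `u'`
(along `N₀'`) lie in `N` and are non-zero, some `r ∈ R` has `B (r • u) u' ≠ 0`.  The `End`-stability of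
`N₀` and `N₀'` is Mathlib's (`Submodule.IsFullyInvariant.isotypicComponent`), not a hypothesis. -/
theorem exists_smul_pairing_ne_zero_isotypicComponent (N : Submodule R M) [IsSimpleModule R N]
    (B : M → M → k) (hBadd : ∀ x y z, B x (y + z) = B x y + B x z)
    (hBorth : ∀ x ∈ isotypicComponent R M N,
      ∀ y ∈ sSup (isotypicComponents R M \ {isotypicComponent R M N}), B x y = 0)
    (hBnd : ∀ y ∈ N, y ≠ 0 → ∃ x ∈ N, B x y ≠ 0) (u u' : M)
    (huN : (isotypicComponent R M N).projection _
      (isCompl_sSup_isotypicComponents_diff (isotypicComponent_mem_isotypicComponents N)) u ∈ N)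
    (hu : (isotypicComponent R M N).projection _
      (isCompl_sSup_isotypicComponents_diff (isotypicComponent_mem_isotypicComponents N)) u ≠ 0)
    (hu'N : (isotypicComponent R M N).projection _
      (isCompl_sSup_isotypicComponents_diff (isotypicComponent_mem_isotypicComponents N)) u' ∈ N)
    (hu' : (isotypicComponent R M N).projection _
      (isCompl_sSup_isotypicComponents_diff (isotypicComponent_mem_isotypicComponents N)) u' ≠ 0) :
    ∃ r : R, B (r • u) u' ≠ 0 :=
  HodgeRepro.T3P1.IsotypicIsolation.exists_smul_pairing_ne_zero_of_le
    (isotypicComponent R M N) _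
    (isCompl_sSup_isotypicComponents_diff (isotypicComponent_mem_isotypicComponents N))
    (fun f _ hx => apply_mem_of_isFullyInvariant (.isotypicComponent R M N) f hx)
    (fun f _ hx =>
      apply_mem_of_isFullyInvariant (isFullyInvariant_sSup_isotypicComponents_diff _) f hx)
    N N.le_isotypicComponent B hBadd hBorth hBnd u u' huN hu hu'N hu'

/-- **The decomposition form.** `u = n + w`, `u' = n' + w'` with `n, n' ∈ N` non-zero and `w, w'` in the sum of
the other isotypic components («`θ₀ ∧ θ₁ = u_τ + (the rest)`»): some `r ∈ R` has `B (r • u) u' ≠ 0`. -/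
theorem exists_smul_pairing_ne_zero_of_add (N : Submodule R M) [IsSimpleModule R N]
    (B : M → M → k) (hBadd : ∀ x y z, B x (y + z) = B x y + B x z)
    (hBorth : ∀ x ∈ isotypicComponent R M N,
      ∀ y ∈ sSup (isotypicComponents R M \ {isotypicComponent R M N}), B x y = 0)
    (hBnd : ∀ y ∈ N, y ≠ 0 → ∃ x ∈ N, B x y ≠ 0)
    {n n' w w' : M} (hn : n ∈ N) (hn0 : n ≠ 0) (hn' : n' ∈ N) (hn'0 : n' ≠ 0)
    (hw : w ∈ sSup (isotypicComponents R M \ {isotypicComponent R M N}))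
    (hw' : w' ∈ sSup (isotypicComponents R M \ {isotypicComponent R M N})) :
    ∃ r : R, B (r • (n + w)) (n' + w') ≠ 0 := by
  have hc := isCompl_sSup_isotypicComponents_diff (isotypicComponent_mem_isotypicComponents N)
  have hp : (isotypicComponent R M N).projection _ hc (n + w) = n := by
    rw [map_add, projection_apply_of_mem_left hc (N.le_isotypicComponent hn),
      projection_apply_of_mem_right hc hw, add_zero]
  have hp' : (isotypicComponent R M N).projection _ hc (n' + w') = n' := by
    rw [map_add, projection_apply_of_mem_left hc (N.le_isotypicComponent hn'),
      projection_apply_of_mem_right hc hw', add_zero]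
  exact exists_smul_pairing_ne_zero_isotypicComponent N B hBadd hBorth hBnd (n + w) (n' + w')
    (by rw [hp]; exact hn) (by rw [hp]; exact hn0) (by rw [hp']; exact hn') (by rw [hp']; exact hn'0)

end Isolation

end HodgeRepro.T3P1.IsotypicComponentIsolation
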